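import Literature.Algebra.Lie.TensorBireflectionObstruction
import Mathlib.LinearAlgebra.Trace
import Mathlib.LinearAlgebra.Matrix.Trace
import Mathlib.LinearAlgebra.BilinearForm.Properties
import HarnessLib

/-!
# The tensor branch `𝔰𝔩(V₂) ⊗ 1 + 1 ⊗ 𝔥` of Katz's Remark 1.4.1 has no rank-`≤ 2` member when its members are skew for a
symplectic form (closing brick (d) of the Hodge cell's lemma BL — a rank count and a parity, no Skolem–Noether)

Elementary linear algebra over a field `K` of characteristic `0`, `dim V₂ = 2`, `dim V′ ≥ 3`:
* `linearIndependent_basis_tmul`, **`finrank_mul_finrank_range_le`** — `dim V₂ · rank h ≤ rank (1 ⊗ h)`;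
* **`finrank_le_finrank_range_of_not_mem_span`** (slice count) — if `A a ∉ K a` then `rank (A ⊗ 1 + 1 ⊗ h) ≥ dim V′`
  (the slice `a ⊗ V′` is mapped injectively: read off the `A a`-component);
* **`not_skew_of_range_le_span`** (parity) — no non-zero `h` with `h(V′) ⊆ K y₀` is skew for a SYMMETRIC bilinear form `β`
  with `β(y₀, ·) ≠ 0` (`β(h y, y) = 0` for all `y`, and `V′` is not the union of two proper subspaces);
* **`false_of_skew_of_finrank_range_le_two`** — MAIN: let `ω` be non-degenerate alternating on `V ≃ V₂ ⊗ V′` and `S` a subspace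
  of `ω`-skew operators containing (the transports of) all `A ⊗ 1`, `tr A = 0`. Then `S` has no member `X ≠ 0` of rank `≤ 2` of
  the shape `A ⊗ 1 + 1 ⊗ h` (`tr A = 0`). PROOF: the slice count forces `A = 0`, so `X = 1 ⊗ h` with `rank h = 1`; the form
  `β(y, y′) := ω(b₀ ⊗ y, b₁ ⊗ y′)` on `V′` is symmetric (skewness of `E₀₁ ⊗ 1`), separating (skewness of `(E₀₀ − E₁₁) ⊗ 1` makes
  `b₀ ⊗ V′` isotropic), and `h` is `β`-skew (skewness of `1 ⊗ h`) — contradicting the parity lemma.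
USE (crux K1Q, lemma BL case (d)): an irreducible `𝔤 ≤ 𝔰𝔭(M, ω)` normalised by an `(i, −i)`-bireflection contains the rank-2
root `s_{u v₊}` (tree: `SymplecticBireflectionGrading`), so `𝔤` is NOT the tensor branch of [Katz, ESDE, Ch. 1, Rmk 1.4.1] —
for every `𝔥`, with no simplicity hypothesis and no separate `dim M = 8` count. THEOREMS only; no Hodge theory here.
[cite: Katz1990ESDE, Ch. 1, Remark 1.4.1 (p. 10)]
-/

namespace Literature.Algebra.Lie

namespace TensorObstruction

open Module TensorProduct
open scoped TensorProduct
open LinearMap (BilinForm)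

variable {K : Type*} [Field K] {V₂ : Type*} [AddCommGroup V₂] [Module K V₂] {V' : Type*} [AddCommGroup V'] [Module K V']

section Rank

/-- Pure tensors `bᵢ ⊗ yⱼ` of a basis `b` of `V₂` with a linearly independent family `y` of `V′` are linearly independent
(read off components with `compo b i`). [cite: Katz1990ESDE, Ch. 1, Remark 1.4.1 (p. 10)] -/
theorem linearIndependent_basis_tmul {ι κ : Type*} [Fintype ι] [Fintype κ] [DecidableEq ι] (b : Basis ι K V₂) {y : κ → V'}
    (hy : LinearIndependent K y) : LinearIndependent K (fun p : ι × κ => b p.1 ⊗ₜ[K] y p.2) := by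
  rw [Fintype.linearIndependent_iff]
  intro g hg p
  have key : ∀ i, ∑ j, g (i, j) • y j = 0 := by
    intro i
    have := congrArg (compo b i) hg
    rw [map_sum, map_zero, Fintype.sum_prod_type] at this
    simp only [map_smul, compo_tmul, Basis.repr_self, Finsupp.single_apply] at this
    rw [Finset.sum_eq_single i (fun i' _ hi' => by simp [hi']) (by simp)] at this
    simpa using this
  exact Fintype.linearIndependent_iff.1 hy (fun j => g (p.1, j)) (key p.1) p.2

variable [FiniteDimensional K V₂] [FiniteDimensional K V']

/-- **`dim V₂ · rank h ≤ rank (1 ⊗ h)`**: the pure tensors `bᵢ ⊗ cⱼ` (`b` a basis of `V₂`, `c` a basis of `h(V′)`) lie in the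
range of `1 ⊗ h` and are independent. [cite: Katz1990ESDE, Ch. 1, Remark 1.4.1 (p. 10)] -/
theorem finrank_mul_finrank_range_le (h : V' →ₗ[K] V') :
    finrank K V₂ * finrank K (LinearMap.range h) ≤
      finrank K (LinearMap.range (TensorProduct.map (LinearMap.id : V₂ →ₗ[K] V₂) h)) := by
  classical
  let b := Module.finBasis K V₂
  let c := Module.finBasis K (LinearMap.range h)
  set T := TensorProduct.map (LinearMap.id : V₂ →ₗ[K] V₂) h with hT
  have hmem : ∀ p : Fin (finrank K V₂) × Fin (finrank K (LinearMap.range h)),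
      b p.1 ⊗ₜ[K] ((c p.2 : LinearMap.range h) : V') ∈ LinearMap.range T := by
    intro p
    obtain ⟨z, hz⟩ := LinearMap.mem_range.1 (c p.2).2
    exact ⟨b p.1 ⊗ₜ[K] z, by rw [hT, TensorProduct.map_tmul, LinearMap.id_apply, hz]⟩
  have hy : LinearIndependent K ((LinearMap.range h).subtype ∘ c) :=
    c.linearIndependent.map' (LinearMap.range h).subtype (Submodule.ker_subtype _)
  have hli := linearIndependent_basis_tmul b hy
  have hli' : LinearIndependent K (fun p => (⟨_, hmem p⟩ : LinearMap.range T)) :=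
    LinearIndependent.of_comp (LinearMap.range T).subtype hli
  have := hli'.fintype_card_le_finrank
  simpa [Fintype.card_prod, Fintype.card_fin] using this

/-- **Slice count: if `A a ∉ K a` then `rank (A ⊗ 1 + 1 ⊗ h) ≥ dim V′`** (`dim V₂ = 2`): on the slice `a ⊗ V′` the operator is
`y ↦ A a ⊗ y + a ⊗ h y`, injective since the `A a`-component (in the basis `(A a, a)`) returns `y`.
[cite: Katz1990ESDE, Ch. 1, Remark 1.4.1 (p. 10)] -/
theorem finrank_le_finrank_range_of_not_mem_span (h2 : finrank K V₂ = 2) {A : V₂ →ₗ[K] V₂} {a : V₂}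
    (ha : A a ∉ K ∙ a) (h : V' →ₗ[K] V') :
    finrank K V' ≤
      finrank K (LinearMap.range (TensorProduct.map A LinearMap.id + TensorProduct.map (LinearMap.id : V₂ →ₗ[K] V₂) h)) := by
  classical
  set T := TensorProduct.map A LinearMap.id + TensorProduct.map (LinearMap.id : V₂ →ₗ[K] V₂) h with hT
  have ha0 : a ≠ 0 := by
    rintro rfl
    exact ha (by rw [map_zero]; exact Submodule.zero_mem _)
  have hli : LinearIndependent K ![A a, a] := by
    refine LinearIndependent.pair_iff.2 fun s t hst => ?_
    by_cases hs : s = 0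
    · subst hs
      simp only [zero_smul, zero_add, smul_eq_zero] at hst
      exact ⟨rfl, hst.resolve_right ha0⟩
    · exfalso
      apply ha
      rw [Submodule.mem_span_singleton]
      refine ⟨-(s⁻¹ * t), ?_⟩
      have hst' : s • A a = -(t • a) := eq_neg_of_add_eq_zero_left hst
      calc -(s⁻¹ * t) • a = s⁻¹ • (-(t • a)) := by rw [neg_smul, mul_smul, smul_neg]
        _ = A a := by rw [← hst', smul_smul, inv_mul_cancel₀ hs, one_smul]
  let b : Basis (Fin 2) K V₂ := basisOfLinearIndependentOfCardEqFinrank hli (by simp [h2])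
  have hb0 : b 0 = A a := by simp [b]
  have hb1 : b 1 = a := by simp [b]
  have hinv : ∀ y : V', compo b 0 (T (a ⊗ₜ[K] y)) = y := by
    intro y
    simp only [hT, LinearMap.add_apply, TensorProduct.map_tmul, LinearMap.id_apply, map_add, compo_tmul]
    rw [← hb0]
    conv_lhs => rw [← hb1]
    simp
  have hinj : Function.Injective (T ∘ₗ TensorProduct.mk K V₂ V' a) := by
    intro y y' hyy
    have := congrArg (compo b 0) hyy
    simpa only [LinearMap.comp_apply, TensorProduct.mk_apply, hinv] using this
  calc finrank K V' = finrank K (LinearMap.range (T ∘ₗ TensorProduct.mk K V₂ V' a)) :=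
        (LinearMap.finrank_range_of_inj hinj).symm
    _ ≤ finrank K (LinearMap.range T) := Submodule.finrank_mono (LinearMap.range_comp_le_range _ _)

/-- A map with values in `K u + K v` has rank `≤ 2`. [cite: Katz1990ESDE, Ch. 1, Remark 1.4.1 (p. 10)] -/
theorem finrank_range_le_two_of_mem_sup {W : Type*} [AddCommGroup W] [Module K W] [FiniteDimensional K W]
    {x : Module.End K W} {u v : W} (hx : ∀ z, x z ∈ (K ∙ u) ⊔ (K ∙ v)) : finrank K (LinearMap.range x) ≤ 2 := by
  have hle : LinearMap.range x ≤ (K ∙ u) ⊔ (K ∙ v) := by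
    rintro _ ⟨z, rfl⟩
    exact hx z
  calc finrank K (LinearMap.range x) ≤ finrank K ↥((K ∙ u) ⊔ (K ∙ v)) := Submodule.finrank_mono hle
    _ ≤ finrank K (K ∙ u) + finrank K (K ∙ v) := Submodule.finrank_add_le_finrank_add_finrank _ _
    _ ≤ 1 + 1 := add_le_add ((finrank_span_le_card ({u} : Set W)).trans (by simp))
        ((finrank_span_le_card ({v} : Set W)).trans (by simp))

end Rank

section Parity

/-- **Parity: no non-zero `h` with `h(V′) ⊆ K y₀` is skew for a symmetric bilinear form `β` with `β(y₀, ·) ≠ 0`** (`2 ≠ 0`).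
Indeed `β(h y, y) = −β(y, h y) = −β(h y, y)` vanishes for every `y`; with `h y₁ ≠ 0` and `β(y₀, y₂) ≠ 0` this forces
`β(y₀, y₁) = 0`, `h y₂ = 0`, and then `y₁ + y₂` violates it. [cite: Katz1990ESDE, Ch. 1, Remark 1.4.1 (p. 10)] -/
theorem not_skew_of_range_le_span {β : BilinForm K V'} (hβs : ∀ y y', β y y' = β y' y) {h : V' →ₗ[K] V'} {y₀ : V'}
    (hy : ∀ y, h y ∈ K ∙ y₀) (hy₀ : ∃ y₂, β y₀ y₂ ≠ 0) (h0 : h ≠ 0) (h2 : (2 : K) ≠ 0)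
    (hskew : ∀ y y', β (h y) y' = -β y (h y')) : False := by
  have hdiag : ∀ y, β (h y) y = 0 := by
    intro y
    have h1 := hskew y y
    rw [hβs y (h y)] at h1
    have : (2 : K) * β (h y) y = 0 := by
      rw [two_mul]
      nth_rewrite 1 [h1]
      exact neg_add_cancel _
    exact (mul_eq_zero.1 this).resolve_left h2
  obtain ⟨y₂, hy₂⟩ := hy₀
  obtain ⟨y₁, hy₁⟩ : ∃ y₁, h y₁ ≠ 0 := by
    by_contra hall
    push Not at hall
    exact h0 (LinearMap.ext hall)
  obtain ⟨t₁, ht₁⟩ := Submodule.mem_span_singleton.1 (hy y₁)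
  obtain ⟨t₂, ht₂⟩ := Submodule.mem_span_singleton.1 (hy y₂)
  have ht₁0 : t₁ ≠ 0 := by
    rintro rfl
    rw [zero_smul] at ht₁
    exact hy₁ ht₁.symm
  have h01 : β y₀ y₁ = 0 := by
    have := hdiag y₁
    rw [← ht₁, map_smul, LinearMap.smul_apply, smul_eq_mul] at this
    exact (mul_eq_zero.1 this).resolve_left ht₁0
  have hy₂0 : h y₂ = 0 := by
    have := hdiag y₂
    rw [← ht₂, map_smul, LinearMap.smul_apply, smul_eq_mul] at this
    have ht₂0 : t₂ = 0 := (mul_eq_zero.1 this).resolve_right hy₂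
    rw [← ht₂, ht₂0, zero_smul]
  have key := hdiag (y₁ + y₂)
  have e1 : h (y₁ + y₂) = t₁ • y₀ := by rw [map_add, hy₂0, add_zero, ht₁]
  rw [e1] at key
  simp only [map_smul, map_add, LinearMap.smul_apply, smul_eq_mul, h01, mul_zero, zero_add] at key
  exact hy₂ ((mul_eq_zero.1 key).resolve_left ht₁0)

end Parity

section Main

variable {V : Type*} [AddCommGroup V] [Module K V]

/-- Transport of skewness along `e : V ≃ V₂ ⊗ V′`: if `x` is `ω`-skew and `e x e⁻¹ = T`, then `T` is skew for the transported
form `(p, q) ↦ ω(e⁻¹ p, e⁻¹ q)`. [cite: Katz1990ESDE, Ch. 1, Remark 1.4.1 (p. 10)] -/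
theorem skew_transport {ω : BilinForm K V} {x : Module.End K V} (hx : ∀ v w, ω (x v) w = -ω v (x w))
    (e : V ≃ₗ[K] V₂ ⊗[K] V') {T : Module.End K (V₂ ⊗[K] V')}
    (hxe : (e : V →ₗ[K] V₂ ⊗[K] V') ∘ₗ x ∘ₗ (e.symm : V₂ ⊗[K] V' →ₗ[K] V) = T) :
    ∀ p q, ω (e.symm (T p)) (e.symm q) = -ω (e.symm p) (e.symm (T q)) := by
  have hT : ∀ p, e.symm (T p) = x (e.symm p) := fun p => by
    rw [← hxe]
    simp only [LinearMap.coe_comp, LinearEquiv.coe_coe, Function.comp_apply, LinearEquiv.symm_apply_apply]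
  intro p q
  rw [hT, hT]
  exact hx _ _

/-- Conjugating by `e : V ≃ V₂ ⊗ V′` preserves the rank. [cite: Katz1990ESDE, Ch. 1, Remark 1.4.1 (p. 10)] -/
theorem finrank_range_conj [FiniteDimensional K V] (e : V ≃ₗ[K] V₂ ⊗[K] V') (x : Module.End K V) :
    finrank K (LinearMap.range ((e : V →ₗ[K] V₂ ⊗[K] V') ∘ₗ x ∘ₗ (e.symm : V₂ ⊗[K] V' →ₗ[K] V))) =
      finrank K (LinearMap.range x) := by
  rw [LinearMap.range_comp, LinearMap.range_comp_of_range_eq_top _ e.symm.range, LinearEquiv.finrank_map_eq]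

variable [FiniteDimensional K V] [FiniteDimensional K V₂] [FiniteDimensional K V'] [CharZero K]

/-- **MAIN: the tensor branch has no `ω`-skew member of rank `≤ 2`.** `ω` non-degenerate alternating on `V`, `e : V ≃ V₂ ⊗ V′`
with `dim V₂ = 2`, `dim V′ ≥ 3`; `S` a subspace of `ω`-skew operators containing a transport of `A ⊗ 1` for every trace-zero
`A`. Then no `X ∈ S`, `X ≠ 0`, of rank `≤ 2` has `e X e⁻¹ = A ⊗ 1 + 1 ⊗ h` with `tr A = 0`. (For Katz's Remark 1.4.1: with
`S = 𝔤 = 𝔰𝔩(V₂) ⊗ 1 + 1 ⊗ 𝔥 ≤ 𝔰𝔭(M, ω)` and `X = s_{u v₊}` this excludes the tensor branch for a `𝔤` normalised by an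
`(i, −i)`-bireflection, whatever `𝔥` is.) [cite: Katz1990ESDE, Ch. 1, Remark 1.4.1 (p. 10)] -/
theorem false_of_skew_of_finrank_range_le_two {ω : BilinForm K V} (hωn : ω.Nondegenerate) (hω : ω.IsAlt)
    (S : Submodule K (Module.End K V)) (hskew : ∀ x ∈ S, ∀ v w, ω (x v) w = -ω v (x w))
    (e : V ≃ₗ[K] V₂ ⊗[K] V') (h2 : finrank K V₂ = 2) (hk : 3 ≤ finrank K V')
    (hA : ∀ A : Module.End K V₂, LinearMap.trace K V₂ A = 0 →
      ∃ x ∈ S, (e : V →ₗ[K] V₂ ⊗[K] V') ∘ₗ x ∘ₗ (e.symm : V₂ ⊗[K] V' →ₗ[K] V) = TensorProduct.map A LinearMap.id)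
    {X : Module.End K V} (hXS : X ∈ S) (hX0 : X ≠ 0) (hXr : finrank K (LinearMap.range X) ≤ 2)
    (hXt : ∃ A : Module.End K V₂, LinearMap.trace K V₂ A = 0 ∧ ∃ h : Module.End K V',
      (e : V →ₗ[K] V₂ ⊗[K] V') ∘ₗ X ∘ₗ (e.symm : V₂ ⊗[K] V' →ₗ[K] V) =
        TensorProduct.map A LinearMap.id + TensorProduct.map LinearMap.id h) : False := by
  classical
  obtain ⟨A, hA0, h, hXe⟩ := hXt
  -- Step 1: `A = 0` by the slice count.
  have hA' : A = 0 := by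
    by_contra hAne
    obtain ⟨a, ha⟩ : ∃ a, A a ∉ K ∙ a := by
      by_contra hall
      push Not at hall
      obtain ⟨c, hc⟩ := exists_eq_smul_id_of_forall_mem_span hall
      rw [hc, map_smul, LinearMap.trace_id, h2, smul_eq_mul] at hA0
      have hc0 : c = 0 := by simpa using hA0
      exact hAne (by rw [hc, hc0, zero_smul])
    have hR := finrank_le_finrank_range_of_not_mem_span h2 ha h
    rw [← hXe, finrank_range_conj] at hR
    omega
  rw [hA', TensorProduct.map_zero_left, zero_add] at hXe
  -- Step 2: `h ≠ 0` of rank `1`.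
  have hh0 : h ≠ 0 := by
    rintro rfl
    apply hX0
    rw [TensorProduct.map_zero_right] at hXe
    ext v
    have := LinearMap.congr_fun hXe (e v)
    simpa using this
  have hr : finrank K (LinearMap.range h) ≤ 1 := by
    have := finrank_mul_finrank_range_le (V₂ := V₂) h
    rw [h2, ← hXe, finrank_range_conj] at this
    omega
  obtain ⟨v, hv⟩ := finrank_le_one_iff.1 hr
  have hy : ∀ y, h y ∈ K ∙ (v : V') := by
    intro y
    obtain ⟨c, hc⟩ := hv ⟨h y, LinearMap.mem_range_self h y⟩
    rw [Submodule.mem_span_singleton]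
    exact ⟨c, by simpa using congrArg Subtype.val hc⟩
  have hy₀0 : (v : V') ≠ 0 := by
    intro hv0
    apply hh0
    ext y
    have := hy y
    rw [hv0, Submodule.span_zero_singleton, Submodule.mem_bot] at this
    simpa using this
  -- Step 3: the basis `b`, the trace-zero operators `N = E₀₁`, `D = E₀₀ − E₁₁`, and their skew transports.
  let b : Basis (Fin 2) K V₂ := Module.finBasisOfFinrankEq K V₂ h2
  let N : Module.End K V₂ := b.constr K ![(0 : V₂), b 0]
  let D : Module.End K V₂ := b.constr K ![b 0, -b 1]
  have hN0 : N (b 0) = 0 := by simp [N]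
  have hN1 : N (b 1) = b 0 := by simp [N]
  have hD0 : D (b 0) = b 0 := by simp [D]
  have hD1 : D (b 1) = -b 1 := by simp [D]
  have htrN : LinearMap.trace K V₂ N = 0 := by
    rw [LinearMap.trace_eq_matrix_trace K b, Matrix.trace_fin_two]
    simp [LinearMap.toMatrix_apply, hN0, hN1]
  have htrD : LinearMap.trace K V₂ D = 0 := by
    rw [LinearMap.trace_eq_matrix_trace K b, Matrix.trace_fin_two]
    simp [LinearMap.toMatrix_apply, hD0, hD1]
  obtain ⟨xN, hxNS, hxN⟩ := hA N htrN
  obtain ⟨xD, hxDS, hxD⟩ := hA D htrD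
  have sN := skew_transport (hskew xN hxNS) e hxN
  have sD := skew_transport (hskew xD hxDS) e hxD
  have sX := skew_transport (hskew X hXS) e hXe
  -- Step 4: the form `β(y, y′) = ω(e⁻¹(b₀ ⊗ y), e⁻¹(b₁ ⊗ y′))` on `V′`.
  let β : BilinForm K V' :=
    (ω.compl₁₂ (e.symm : V₂ ⊗[K] V' →ₗ[K] V) (e.symm : V₂ ⊗[K] V' →ₗ[K] V)).compl₁₂ (TensorProduct.mk K V₂ V' (b 0))
      (TensorProduct.mk K V₂ V' (b 1))
  have hβ : ∀ y y', β y y' = ω (e.symm (b 0 ⊗ₜ[K] y)) (e.symm (b 1 ⊗ₜ[K] y')) := fun y y' => rfl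
  -- symmetric (skewness of `N ⊗ 1`)
  have hβs : ∀ y y', β y y' = β y' y := by
    intro y y'
    rw [hβ, hβ]
    have := sN (b 1 ⊗ₜ[K] y) (b 1 ⊗ₜ[K] y')
    rw [TensorProduct.map_tmul, TensorProduct.map_tmul, hN1, LinearMap.id_apply, LinearMap.id_apply] at this
    rw [this, LinearMap.IsAlt.neg hω]
  -- separating (skewness of `D ⊗ 1` makes `b₀ ⊗ V′` isotropic)
  have hβn : ∀ y, y ≠ 0 → ∃ y', β y y' ≠ 0 := by
    intro y hy0
    by_contra hall
    push Not at hall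
    have h00 : ∀ y', ω (e.symm (b 0 ⊗ₜ[K] y)) (e.symm (b 0 ⊗ₜ[K] y')) = 0 := by
      intro y'
      have := sD (b 0 ⊗ₜ[K] y) (b 0 ⊗ₜ[K] y')
      rw [TensorProduct.map_tmul, TensorProduct.map_tmul, hD0, LinearMap.id_apply, LinearMap.id_apply] at this
      exact CharZero.eq_neg_self_iff.1 this
    have h01 : ∀ y', ω (e.symm (b 0 ⊗ₜ[K] y)) (e.symm (b 1 ⊗ₜ[K] y')) = 0 := fun y' => by rw [← hβ]; exact hall y'
    have hall' : ∀ w : V, ω (e.symm (b 0 ⊗ₜ[K] y)) w = 0 := by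
      intro w
      obtain ⟨q, rfl⟩ : ∃ q, e.symm q = w := ⟨e w, e.symm_apply_apply w⟩
      rw [← sum_tmul_compo b q, Fin.sum_univ_two, map_add, map_add, h00, h01, add_zero]
    have h0 := hωn.1 _ hall'
    rw [LinearEquiv.map_eq_zero_iff] at h0
    exact hy0 (eq_zero_of_tmul_eq_zero (b.ne_zero 0) h0)
  -- `h` is `β`-skew (skewness of `1 ⊗ h`)
  have hhs : ∀ y y', β (h y) y' = -β y (h y') := by
    intro y y'
    rw [hβ, hβ]
    have := sX (b 0 ⊗ₜ[K] y) (b 1 ⊗ₜ[K] y')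
    rwa [TensorProduct.map_tmul, TensorProduct.map_tmul, LinearMap.id_apply, LinearMap.id_apply] at this
  exact not_skew_of_range_le_span hβs hy (hβn _ hy₀0) hh0 two_ne_zero hhs

end Main

end TensorObstruction

end Literature.Algebra.Lie
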